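import Literature.MathematicalPhysics.QuantumLattice.HubbardOpenBoxGeneralPairCluster
import HarnessLib

/-!
# The coded cluster oracle of the general-pair weighted cluster (kernel ED floors of any one-orbital-per-site window)

Topic `MathematicalPhysics/QuantumLattice`, family `hubbard`. The instance of the generic data-free floor chain
(`HubbardOpenBoxCodedClusterRows` / `…Certificate` / `…CertificateBlocks`) for the general-pair cluster
`hubbardOpenBoxGP a b (W/Q) (V/Q) (M/Q)` of `HubbardOpenBoxGeneralPairCluster` (arbitrary symmetric hopping table on the
`ab` ranks, per-site repulsion and potential tables): oracle **`gpCluster a b W V M`** (coded application by the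
all-pairs adjacency list `hopOrbsW W neAdjCode (ab)`, bound `hzBoundW`), its vector dictionary
`hubbardOpenBoxGP_mulVec_code{_div}`, `abs_hzIntGP_le`, **`gpCluster_models`**, and the certificate form
**`groundEnergy_ge_of_kCertsGP₃`** (`KCert.PassesG`, sectors `p ≤ q`) ⇒ `σ ≤ E₀(h^G, k)` — the sector floors consumed,
after the consumer's relabelling, by the Cu–O window laws of the three-band model
(`le_emeryEnergyDensity_of_cuO4Certificate`, `EmeryThreeBandCuO4WindowFloor`).

Everything is proved; no named fact; nothing numerical is asserted here.

## References

* H. Q. Lin, J. E. Gubernatis, Comput. Phys. 7 (1993) 400, §II. [cite: LinGubernatis1993, §II]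
* R. Valentí, J. Stolze, P. J. Hirschfeld, Phys. Rev. B 43 (1991) 13743, §II. [cite: ValentiStolzeHirschfeld1991, §II]
* V. J. Emery, PRL 58 (1987) 2794, eq. (1). [cite: Emery1987, eq. (1)]
* I. Kull, N. Schuch, B. Dive, M. Navascués, PRX 14 (2024) 021008, §5.3. [cite: KullEtAl2024, §5.3]
-/

noncomputable section

namespace Literature.MathematicalPhysics.QuantumLattice

namespace OccupationCode

open Finset Matrix ClusterLowerBound Literature.Computation.Certificates

/-- **THE ORACLE of the general-pair cluster** `Q·h^G_{a×b}(W/Q, V/Q, M/Q)`: coded application by the all-pairs adjacency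
list, bound `hzBoundW`. [cite: LinGubernatis1993, §II] [cite: ValentiStolzeHirschfeld1991, §II] -/
def gpCluster (a b : ℕ) (W : ℕ → ℕ → ℤ) (V M : ℕ → ℤ) : CodedCluster where
  app m f := -hopListSumW m f (hopOrbsW W neAdjCode (a * b)) + (doccOfW V (a * b) m + densOfW M (a * b) m) * f m
  bound := hzBoundW (a * b) W V M

section Box

variable {a b : ℕ}

/-- Applying a finite sum of matrices. [folklore] -/
private theorem sum_mulVec_apply₃ {ι κ : Type*} [Fintype κ] (S : Finset ι) (A : ι → Matrix κ κ ℂ) (v : κ → ℂ)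
    (x : κ) : ((∑ i ∈ S, A i) *ᵥ v) x = ∑ i ∈ S, (A i *ᵥ v) x := by
  rw [Matrix.sum_mulVec, Finset.sum_apply]

/-- The all-pairs weighted hopping part applied to a coded vector, in code form. [cite: LinGubernatis1993, §II] -/
theorem sum_hopGP_mulVec_code (W : ℕ → ℕ → ℤ) (f : ℕ → ℤ) (s : Finset (Orb (Fin a ×ₗ Fin b))) :
    ((∑ x : Fin a ×ₗ Fin b, ∑ y : Fin a ×ₗ Fin b, ∑ σ : Fin 2,
        if x ≠ y then (((W (siteRank x) (siteRank y) : ℤ) : ℝ) : ℂ) • (creation (orb x σ) * annihilation (orb y σ)) else 0) *ᵥ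
        codedVec f) s =
      ((openBoxHopApplyW W neAdjCode (a * b) (code s) f : ℤ) : ℂ) := by
  have hcast : ((openBoxHopApplyW W neAdjCode (a * b) (code s) f : ℤ) : ℂ) =
      sumNat (fun P => sumNat (fun Q => if neAdjCode P Q then
        ((W P Q : ℤ) : ℂ) * sumNat (fun σ => (hopApply (2 * P + σ) (2 * Q + σ) (code s) f : ℂ)) 2 else 0) (a * b))
        (a * b) := by
    simp only [openBoxHopApplyW, sumNat_eq]
    push_cast
    rfl
  rw [hcast, sum_mulVec_apply₃, ← sum_site_eq_sumNat]
  refine Finset.sum_congr rfl fun x _ => ?_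
  rw [sum_mulVec_apply₃, ← sum_site_eq_sumNat]
  refine Finset.sum_congr rfl fun y _ => ?_
  rw [sum_mulVec_apply₃]
  by_cases hxy : x ≠ y
  · rw [if_pos ((neAdjCode_siteRank x y).2 hxy), Fin.sum_univ_two, if_pos hxy, if_pos hxy, Matrix.smul_mulVec,
      Matrix.smul_mulVec, Pi.smul_apply, Pi.smul_apply, smul_eq_mul, smul_eq_mul, sumNat, sumNat, sumNat,
      creation_mul_annihilation_mulVec_code, creation_mul_annihilation_mulVec_code,
      orbRank_orb, orbRank_orb, orbRank_orb, orbRank_orb]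
    push_cast
    simp only [Fin.val_zero, Fin.val_one, add_zero, zero_add]
    ring
  · have : neAdjCode (siteRank x) (siteRank y) = false := Bool.eq_false_iff.2 fun h => hxy ((neAdjCode_siteRank x y).1 h)
    rw [this]
    simp [hxy]

/-- **The general-pair cluster on a coded vector** (integer tables): `(h^G(W,V,M) φ_f)(s) = (gpCluster a b W V M).app (code s) f`.
[cite: LinGubernatis1993, §II] -/
theorem hubbardOpenBoxGP_mulVec_code (W : ℕ → ℕ → ℤ) (V M : ℕ → ℤ) (f : ℕ → ℤ) (s : Finset (Orb (Fin a ×ₗ Fin b))) :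
    (hubbardOpenBoxGP a b (fun x y => ((W (siteRank x) (siteRank y) : ℤ) : ℝ)) (fun x => ((V (siteRank x) : ℤ) : ℝ))
        (fun x => ((M (siteRank x) : ℤ) : ℝ)) *ᵥ codedVec f) s =
      (((gpCluster a b W V M).app (code s) f : ℤ) : ℂ) := by
  rw [hubbardOpenBoxGP, add_mulVec, add_mulVec, neg_mulVec, Pi.add_apply, Pi.add_apply, Pi.neg_apply,
    sum_hopGP_mulVec_code, sum_doccW_mulVec_code, sum_densW_mulVec_code]
  show _ = (((-hopListSumW (code s) f (hopOrbsW W neAdjCode (a * b)) +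
    (doccOfW V (a * b) (code s) + densOfW M (a * b) (code s)) * f (code s) : ℤ) : ℤ) : ℂ)
  rw [hopListSumW_hopOrbsW]
  push_cast
  ring

/-- **The general-pair cluster on a coded vector** (rational tables): `(h^G φ_f)(s) = app (code s) f / Q`.
[cite: LinGubernatis1993, §II] -/
theorem hubbardOpenBoxGP_mulVec_code_div (W : ℕ → ℕ → ℤ) (V M : ℕ → ℤ) (Q : ℕ) (f : ℕ → ℤ)
    (s : Finset (Orb (Fin a ×ₗ Fin b))) :
    (hubbardOpenBoxGP a b (fun x y => (W (siteRank x) (siteRank y) : ℝ) / Q) (fun x => (V (siteRank x) : ℝ) / Q)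
        (fun x => (M (siteRank x) : ℝ) / Q) *ᵥ codedVec f) s =
      (((gpCluster a b W V M).app (code s) f : ℝ) : ℂ) / ((Q : ℝ) : ℂ) := by
  have h := hubbardOpenBoxGP_scale (a := a) (b := b) (Q : ℝ)⁻¹ (fun x y => (W (siteRank x) (siteRank y) : ℝ))
    (fun x => (V (siteRank x) : ℝ)) (fun x => (M (siteRank x) : ℝ))
  simp only [← div_eq_inv_mul] at h
  rw [h, Matrix.smul_mulVec, Pi.smul_apply, smul_eq_mul]
  have h2 := hubbardOpenBoxGP_mulVec_code (a := a) (b := b) W V M f s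
  push_cast at h2 ⊢
  rw [h2]
  ring

/-- Structural sums of bounded integers are bounded by the sum of the bounds. [folklore] -/
private theorem abs_sumNat_le_sumNat₃ (f : ℕ → ℤ) (g : ℕ → ℕ) (hf : ∀ i, |f i| ≤ (g i : ℤ)) :
    ∀ n : ℕ, |sumNat f n| ≤ ((sumNat g n : ℕ) : ℤ)
  | 0 => by simp [sumNat]
  | n + 1 => by
      rw [sumNat, sumNat, Nat.cast_add]
      exact (abs_add_le _ _).trans (add_le_add (abs_sumNat_le_sumNat₃ f g hf n) (hf n))

/-- `|openBoxHopW W adj N m m'| ≤ 2·ΣΣ|W|` for any coded adjacency. [cite: LinGubernatis1993, §II] -/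
theorem abs_openBoxHopW_le_sum (W : ℕ → ℕ → ℤ) (adj : ℕ → ℕ → Bool) (N m m' : ℕ) :
    |openBoxHopW W adj N m m'| ≤ 2 * ((sumNat (fun P => sumNat (fun Q => (W P Q).natAbs) N) N : ℕ) : ℤ) := by
  unfold openBoxHopW
  have key := abs_sumNat_le_sumNat₃ (fun P => sumNat (fun Q => if adj P Q then
      W P Q * sumNat (fun σ => hopCode (2 * P + σ) (2 * Q + σ) m m') 2 else 0) N)
    (fun P => sumNat (fun Q => 2 * (W P Q).natAbs) N) (fun P => ?_) N
  · refine key.trans ?_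
    have e : ∀ n, sumNat (fun P => sumNat (fun Q => 2 * (W P Q).natAbs) N) n =
        2 * sumNat (fun P => sumNat (fun Q => (W P Q).natAbs) N) n := by
      intro n
      have e1 : ∀ P k, sumNat (fun Q => 2 * (W P Q).natAbs) k = 2 * sumNat (fun Q => (W P Q).natAbs) k := by
        intro P k; induction k with
        | zero => simp [sumNat]
        | succ k ih => rw [sumNat, sumNat, ih]; ring
      induction n with
      | zero => simp [sumNat]
      | succ n ih => rw [sumNat, sumNat, ih, e1]; ring
    rw [e N]; push_cast; exact le_rfl
  · refine abs_sumNat_le_sumNat₃ _ _ (fun Q => ?_) N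
    split_ifs
    · have h2 := abs_sumNat_le_sumNat₃ (fun σ => hopCode (2 * P + σ) (2 * Q + σ) m m') (fun _ => 1)
        (fun σ => by unfold hopCode; split_ifs <;> simp) 2
      have h2' : |sumNat (fun σ => hopCode (2 * P + σ) (2 * Q + σ) m m') 2| ≤ 2 := by
        simpa [sumNat] using h2
      rw [abs_mul]
      calc |W P Q| * |sumNat (fun σ => hopCode (2 * P + σ) (2 * Q + σ) m m') 2|
          ≤ |W P Q| * 2 := mul_le_mul_of_nonneg_left h2' (abs_nonneg _)
        _ = ((2 * (W P Q).natAbs : ℕ) : ℤ) := by push_cast; ring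
    · simp

/-- **`|hzIntGP a b W V M m m'| ≤ hzBoundW (ab) W V M`.** [cite: LinGubernatis1993, §II] -/
theorem abs_hzIntGP_le (W : ℕ → ℕ → ℤ) (V M : ℕ → ℤ) (m m' : ℕ) :
    |hzIntGP a b W V M m m'| ≤ (hzBoundW (a * b) W V M : ℤ) := by
  have h1 := abs_openBoxHopW_le_sum W neAdjCode (a * b) m m'
  have hdd : |doccCodeW V (a * b) m m' + densCodeW M (a * b) m m'| ≤
      ((sumNat (fun P => (V P).natAbs) (a * b) : ℕ) : ℤ) + 2 * ((sumNat (fun P => (M P).natAbs) (a * b) : ℕ) : ℤ) := by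
    have hd : |doccCodeW V (a * b) m m'| ≤ ((sumNat (fun P => (V P).natAbs) (a * b) : ℕ) : ℤ) := by
      unfold doccCodeW
      split_ifs
      · exact abs_sumNat_le_sumNat₃ _ _ (fun P => by
          split_ifs
          · exact le_of_eq (Int.natCast_natAbs (V P)).symm
          · simp) _
      · simp
    have hn : |densCodeW M (a * b) m m'| ≤ 2 * ((sumNat (fun P => (M P).natAbs) (a * b) : ℕ) : ℤ) := by
      unfold densCodeW
      split_ifs
      · have key := abs_sumNat_le_sumNat₃ (fun P => (if m.testBit (2 * P) then M P else 0) +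
            (if m.testBit (2 * P + 1) then M P else 0)) (fun P => 2 * (M P).natAbs) (fun P => ?_) (a * b)
        · refine key.trans ?_
          have e2 : ∀ n, sumNat (fun P => 2 * (M P).natAbs) n = 2 * sumNat (fun P => (M P).natAbs) n := by
            intro n; induction n with
            | zero => simp [sumNat]
            | succ n ih => rw [sumNat, sumNat, ih]; ring
          rw [e2]; push_cast; exact le_rfl
        · refine (abs_add_le _ _).trans ?_
          push_cast
          split_ifs <;> (try simp only [abs_zero, add_zero, zero_add]) <;> linarith [abs_nonneg (M P)]
      · simp
    exact (abs_add_le _ _).trans (add_le_add hd hn)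
  have e2 : hzIntGP a b W V M m m' = -openBoxHopW W neAdjCode (a * b) m m' +
      (doccCodeW V (a * b) m m' + densCodeW M (a * b) m m') := by unfold hzIntGP; ring
  rw [e2]
  unfold hzBoundW
  refine (abs_add_le _ _).trans ?_
  rw [abs_neg]
  push_cast
  linarith

/-- **SEMANTICS OF THE GENERAL-PAIR ORACLE** (symmetric `W`, any `Q`). [cite: LinGubernatis1993, §II] -/
theorem gpCluster_models (W : ℕ → ℕ → ℤ) (hW : ∀ P Q, W P Q = W Q P) (V M : ℕ → ℤ) (Q : ℕ) :
    (gpCluster a b W V M).Models a b (hzIntGP a b W V M) Q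
      (hubbardOpenBoxGP a b (fun x y => (W (siteRank x) (siteRank y) : ℝ) / Q) (fun x => (V (siteRank x) : ℝ) / Q)
        (fun x => (M (siteRank x) : ℝ) / Q)) where
  apply_eq s s' := by
    rw [hubbardOpenBoxGP_apply_eq_hzIntGP_div, Complex.ofReal_div]
  mulVec_eq f s := hubbardOpenBoxGP_mulVec_code_div W V M Q f s
  preserves := preservesSectors_hubbardOpenBoxGP _ _ _
  symm s s' := hzIntGP_code_symm W hW V M s s'
  abs_le m m' := abs_hzIntGP_le W V M m m'

end Box

/-- **Certificate form for the general-pair cluster (sectors `p ≤ q`, checks in pieces).** For the cluster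
`h^G_{a×b}(W/Q, V/Q, M/Q)` (`W` symmetric) and a particle number `k ≤ 2ab`: if for every `p ≤ k` with `p ≤ k − p` a data-free
certificate with code list `Ls p` of the spin sector `(p, k − p)` PASSES the generic kernel checker for `gpCluster a b W V M`
and its floor is `≥ σ`, then `σ ≤ E₀(h^G, k)`. [cite: KullEtAl2024, §5.3] [cite: ValentiStolzeHirschfeld1991, §II] -/
theorem groundEnergy_ge_of_kCertsGP₃ (a b : ℕ) (W : ℕ → ℕ → ℤ) (hW : ∀ P Q, W P Q = W Q P) (V M : ℕ → ℤ) (Q : ℕ)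
    {k : ℕ} (hk : k ≤ 2 * (a * b)) (σ : ℚ) (Ls : ℕ → List ℕ) (certs : ℕ → KCert)
    (hpass : ∀ p ≤ k, p ≤ k - p → (certs p).PassesG (gpCluster a b W V M) a b p (k - p) Q (Ls p))
    (hσ : ∀ p ≤ k, p ≤ k - p → σ ≤ (certs p).floor Q) :
    (σ : ℝ) ≤ groundEnergy (hubbardOpenBoxGP a b (fun x y => (W (siteRank x) (siteRank y) : ℝ) / Q)
      (fun x => (V (siteRank x) : ℝ) / Q) (fun x => (M (siteRank x) : ℝ) / Q)) k :=
  groundEnergy_ge_of_kCertsG₃ (gpCluster_models W hW V M Q) (relabel_spinSwap_hubbardOpenBoxGP _ _ _)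
    hk σ Ls certs hpass hσ

end OccupationCode

end Literature.MathematicalPhysics.QuantumLattice
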